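import Mathlib
import HarnessLib
import Literature.MathematicalPhysics.QuantumLattice.PairFieldMomentum

/-!
# Route `AposterioriCapRg` — crux `SsbToEvenTorusLro` (stmt-HubbardSuperconductivity-1315),
# line `pair-yrast-landau-floor`, stub `stub_windowLatticeSum`

The punctured-window lattice sum on the two-dimensional discrete torus `(ℤ/Lℤ)²`: for an exponent
`α < 2` and `ε > 0`, for all small windows `η ≤ η₁` and all sides `L`,
`Σ_{m ≠ 0, |q_m|² < η²} (|q_m|²)^{-α/2} ≤ ε L²`, where `|q_m|² = momentumNormSq L m =
(2π/L)² Σᵢ (valMinAbs mᵢ)²` is the squared Brillouin-zone momentum of the label `m`.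

Proof (pure real analysis). The integer coordinates `v(m) = (valMinAbs m₀, valMinAbs m₁) ∈ ℤ²` are
injective in `m`, `|q_m|² = (2π/L)² |v(m)|²`, `m ≠ 0 ↔ v(m) ≠ 0`, and the window `|q_m| < η` forces
`|vᵢ| ≤ R := ⌊ηL/2π⌋`. Hence for `0 ≤ α < 2` the sum is at most
`(L/2π)^α Σ_{v ∈ [-R,R]² ∖ 0} |v|^{-α}`; peeling the box `[-R,R]²` into sup-norm shells
(`#([-r-1,r+1]² ∖ [-r,r]²) = 8(r+1)` points, each with `|v| ≥ r+1`) gives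
`Σ_{v ∈ [-R,R]² ∖ 0} |v|^{-α} ≤ 8 Σ_{r<R} (r+1)^{1-α} ≤ 8 (1 + 1/(2-α)) R^{2-α}` (termwise for
`α ≤ 1`, and by the Bernoulli telescoping `(2-α)(r+1)^{1-α} ≤ (r+1)^{2-α} - r^{2-α}` for
`1 < α < 2`), so the window sum is `≤ 8(1 + 1/(2-α)) (L/2π)^α (ηL/2π)^{2-α} ≤
8(1 + 1/(2-α)) η^{2-α} L²`, which is `≤ ε L²` once `η^{2-α} ≤ ε / (8(1 + 1/(2-α)))`. For `α < 0`
the summand is `≤ 1` on the window (`|q_m|² < η² ≤ 1`), so the case `α = 0` applies.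
-/

namespace Summit.HubbardSuperconductivity.HubbardSuperconductivity.Theorems

set_option linter.dupNamespace false

open Literature.MathematicalPhysics.QuantumLattice Literature.Probability.LatticeModels
open Finset Fintype

/-! ### Sup-norm shells in `ℤ²` -/

/-- `#[-R,R]² = (2R+1)²`. [folklore] -/
theorem wls_card_box (R : ℕ) :
    (#(piFinset fun _ : Fin 2 => Icc (-(R : ℤ)) R) : ℝ) = (2 * R + 1) ^ 2 := by
  have h : (R : ℤ) + 1 - -(R : ℤ) = ((2 * R + 1 : ℕ) : ℤ) := by push_cast; ring
  rw [card_piFinset_const, Int.card_Icc, h, Int.toNat_natCast]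
  push_cast
  ring

/-- The boxes `[-R,R]²` increase with `R`. [folklore] -/
theorem wls_box_mono {R R' : ℕ} (h : R ≤ R') :
    (piFinset fun _ : Fin 2 => Icc (-(R : ℤ)) R) ⊆ piFinset fun _ : Fin 2 => Icc (-(R' : ℤ)) R' :=
  piFinset_subset _ _ fun _ => Icc_subset_Icc (by omega) (by omega)

/-- Outside the box `[-R,R]²` the squared Euclidean norm is at least `(R+1)²`. [folklore] -/
theorem wls_sq_le_of_not_mem {R : ℕ} {v : Fin 2 → ℤ}
    (hv : v ∉ piFinset fun _ : Fin 2 => Icc (-(R : ℤ)) R) :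
    ((R : ℝ) + 1) ^ 2 ≤ ∑ i, ((v i : ℤ) : ℝ) ^ 2 := by
  rw [mem_piFinset, not_forall] at hv
  obtain ⟨i, hi⟩ := hv
  rw [mem_Icc, not_and_or, not_le, not_le] at hi
  have habs : (R : ℤ) + 1 ≤ |v i| := by
    rcases hi with h | h
    · rw [abs_of_neg (by omega)]; omega
    · rw [abs_of_pos (by omega)]; omega
  have habs' : (R : ℝ) + 1 ≤ |((v i : ℤ) : ℝ)| := by
    rw [← Int.cast_abs]; exact_mod_cast habs
  calc ((R : ℝ) + 1) ^ 2 ≤ |((v i : ℤ) : ℝ)| ^ 2 := by gcongr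
    _ = ((v i : ℤ) : ℝ) ^ 2 := sq_abs _
    _ ≤ ∑ j, ((v j : ℤ) : ℝ) ^ 2 :=
        single_le_sum (f := fun j => ((v j : ℤ) : ℝ) ^ 2) (fun j _ => sq_nonneg _) (mem_univ i)

/-- `x · (x²)^{-α/2} = x^{1-α}` for `x > 0`. [folklore] -/
theorem wls_mul_sq_rpow {x : ℝ} (hx : 0 < x) (α : ℝ) :
    x * (x ^ 2) ^ (-(α / 2)) = x ^ (1 - α) := by
  have h2 : (x ^ 2) ^ (-(α / 2)) = x ^ (-α) := by
    rw [← Real.rpow_two x, ← Real.rpow_mul hx.le]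
    congr 1
    ring
  rw [h2, sub_eq_add_neg, Real.rpow_add hx, Real.rpow_one]

/-- **Shell bound.** For `α ≥ 0`, `Σ_{v ∈ [-R,R]² ∖ 0} (|v|²)^{-α/2} ≤ 8 Σ_{r < R} (r+1)^{1-α}`:
the shell `[-r-1,r+1]² ∖ [-r,r]²` has `8(r+1)` points, each with `|v|² ≥ (r+1)²`. [folklore] -/
theorem wls_shell_sum_le {α : ℝ} (hα : 0 ≤ α) (R : ℕ) :
    ∑ v ∈ (piFinset fun _ : Fin 2 => Icc (-(R : ℤ)) R).filter (· ≠ 0),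
        (∑ i, ((v i : ℤ) : ℝ) ^ 2) ^ (-(α / 2)) ≤
      8 * ∑ r ∈ range R, ((r : ℝ) + 1) ^ (1 - α) := by
  induction R with
  | zero =>
    rw [sum_range_zero, mul_zero]
    refine (Finset.sum_eq_zero fun v hv => ?_).le
    exfalso
    rw [mem_filter] at hv
    refine hv.2 (funext fun i => ?_)
    have hi := mem_piFinset.1 hv.1 i
    rw [mem_Icc] at hi
    show v i = 0
    omega
  | succ R ih =>
    set B := piFinset fun _ : Fin 2 => Icc (-(R : ℤ)) R with hB
    set B' := piFinset fun _ : Fin 2 => Icc (-((R + 1 : ℕ) : ℤ)) ((R + 1 : ℕ) : ℤ) with hB'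
    have hmono : B ⊆ B' := wls_box_mono (Nat.le_succ R)
    have hsub : B'.filter (· ≠ 0) ⊆ B.filter (· ≠ 0) ∪ (B' \ B) := by
      intro v hv
      rw [mem_filter] at hv
      rw [mem_union, mem_filter, mem_sdiff]
      by_cases h : v ∈ B
      · exact Or.inl ⟨h, hv.2⟩
      · exact Or.inr ⟨hv.1, h⟩
    have hdisj : Disjoint (B.filter (· ≠ 0)) (B' \ B) :=
      disjoint_sdiff.mono_left (filter_subset _ _)
    have hcard : (#(B' \ B) : ℝ) = 8 * ((R : ℝ) + 1) := by
      have h' : (#(B' \ B) : ℝ) + (#B : ℝ) = #B' := by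
        exact_mod_cast card_sdiff_add_card_eq_card hmono
      have hcB : (#B : ℝ) = (2 * R + 1) ^ 2 := wls_card_box R
      have hcB' : (#B' : ℝ) = (2 * ((R + 1 : ℕ) : ℝ) + 1) ^ 2 := wls_card_box (R + 1)
      push_cast at hcB'
      linear_combination h' - hcB + hcB'
    have hRpos : (0 : ℝ) < (R : ℝ) + 1 := by positivity
    have hshell : ∑ v ∈ B' \ B, (∑ i, ((v i : ℤ) : ℝ) ^ 2) ^ (-(α / 2)) ≤
        8 * ((R : ℝ) + 1) ^ (1 - α) := by
      have hterm : ∀ v ∈ B' \ B, (∑ i, ((v i : ℤ) : ℝ) ^ 2) ^ (-(α / 2)) ≤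
          (((R : ℝ) + 1) ^ 2) ^ (-(α / 2)) := by
        intro v hv
        rw [mem_sdiff] at hv
        exact Real.rpow_le_rpow_of_nonpos (by positivity) (wls_sq_le_of_not_mem hv.2) (by linarith)
      calc ∑ v ∈ B' \ B, (∑ i, ((v i : ℤ) : ℝ) ^ 2) ^ (-(α / 2))
          ≤ #(B' \ B) • (((R : ℝ) + 1) ^ 2) ^ (-(α / 2)) := sum_le_card_nsmul _ _ _ hterm
        _ = 8 * (((R : ℝ) + 1) * (((R : ℝ) + 1) ^ 2) ^ (-(α / 2))) := by rw [nsmul_eq_mul, hcard]; ring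
        _ = 8 * ((R : ℝ) + 1) ^ (1 - α) := by rw [wls_mul_sq_rpow hRpos]
    calc ∑ v ∈ B'.filter (· ≠ 0), (∑ i, ((v i : ℤ) : ℝ) ^ 2) ^ (-(α / 2))
        ≤ ∑ v ∈ B.filter (· ≠ 0) ∪ (B' \ B), (∑ i, ((v i : ℤ) : ℝ) ^ 2) ^ (-(α / 2)) :=
          sum_le_sum_of_subset_of_nonneg hsub fun v _ _ => by positivity
      _ = ∑ v ∈ B.filter (· ≠ 0), (∑ i, ((v i : ℤ) : ℝ) ^ 2) ^ (-(α / 2)) +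
            ∑ v ∈ B' \ B, (∑ i, ((v i : ℤ) : ℝ) ^ 2) ^ (-(α / 2)) := sum_union hdisj
      _ ≤ 8 * ∑ r ∈ range R, ((r : ℝ) + 1) ^ (1 - α) + 8 * ((R : ℝ) + 1) ^ (1 - α) :=
          add_le_add ih hshell
      _ = 8 * ∑ r ∈ range (R + 1), ((r : ℝ) + 1) ^ (1 - α) := by
          rw [sum_range_succ]; ring

/-- **One-dimensional power sum.** For `α < 2`, `Σ_{r<R} (r+1)^{1-α} ≤ (1 + 1/(2-α)) R^{2-α}`:
termwise for `α ≤ 1`; for `1 < α < 2` by the Bernoulli telescoping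
`(2-α)(r+1)^{1-α} ≤ (r+1)^{2-α} - r^{2-α}`. [folklore] -/
theorem wls_sum_rpow_le {α : ℝ} (hα : α < 2) (R : ℕ) :
    ∑ r ∈ range R, ((r : ℝ) + 1) ^ (1 - α) ≤ (1 + 1 / (2 - α)) * (R : ℝ) ^ (2 - α) := by
  have hs : 0 < 2 - α := sub_pos.2 hα
  have hs' : 0 < 1 / (2 - α) := one_div_pos.2 hs
  have hRs : 0 ≤ (R : ℝ) ^ (2 - α) := Real.rpow_nonneg (Nat.cast_nonneg R) _
  rcases le_or_gt α 1 with h1 | h1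
  · -- each term is at most `R^{1-α}`
    have hterm : ∀ r ∈ range R, ((r : ℝ) + 1) ^ (1 - α) ≤ (R : ℝ) ^ (1 - α) := by
      intro r hr
      have hr' : (r : ℝ) + 1 ≤ R := by
        exact_mod_cast Nat.lt_iff_add_one_le.1 (mem_range.1 hr)
      exact Real.rpow_le_rpow (by positivity) hr' (by linarith)
    calc ∑ r ∈ range R, ((r : ℝ) + 1) ^ (1 - α)
        ≤ ∑ _r ∈ range R, (R : ℝ) ^ (1 - α) := sum_le_sum hterm
      _ = (R : ℝ) ^ (2 - α) := by
          rw [sum_const, card_range, nsmul_eq_mul, show (2 : ℝ) - α = 1 + (1 - α) by ring,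
            Real.rpow_add' (Nat.cast_nonneg R) (ne_of_gt (by linarith)), Real.rpow_one]
      _ ≤ (1 + 1 / (2 - α)) * (R : ℝ) ^ (2 - α) := le_mul_of_one_le_left hRs (by linarith)
  · -- `1 < α < 2`: telescoping
    have hs1 : 2 - α ≤ 1 := by linarith
    have htel : ∀ r : ℕ, (2 - α) * ((r : ℝ) + 1) ^ (1 - α) ≤
        ((r : ℝ) + 1) ^ (2 - α) - (r : ℝ) ^ (2 - α) := by
      intro r
      have hx : (0 : ℝ) < (r : ℝ) + 1 := by positivity
      have hr0 : (0 : ℝ) ≤ r := Nat.cast_nonneg r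
      have hx1 : (1 : ℝ) ≤ (r : ℝ) + 1 := by linarith
      have hinv : (-1 : ℝ) ≤ -((r : ℝ) + 1)⁻¹ := by
        rw [neg_le_neg_iff]; exact inv_le_one_of_one_le₀ hx1
      have hB := rpow_one_add_le_one_add_mul_self hinv hs.le hs1
      have h1x : (1 : ℝ) + -((r : ℝ) + 1)⁻¹ = r / ((r : ℝ) + 1) := by
        rw [eq_div_iff hx.ne', add_mul, one_mul, neg_mul, inv_mul_cancel₀ hx.ne']
        ring
      rw [h1x, Real.div_rpow hr0 hx.le, div_le_iff₀ (Real.rpow_pos_of_pos hx _)] at hB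
      have hxs : ((r : ℝ) + 1) ^ (1 - α) = ((r : ℝ) + 1) ^ (2 - α) * ((r : ℝ) + 1)⁻¹ := by
        rw [show (1 : ℝ) - α = (2 - α) - 1 by ring, Real.rpow_sub_one hx.ne', div_eq_mul_inv]
      rw [hxs]
      linarith [hB]
    have hsum : (2 - α) * ∑ r ∈ range R, ((r : ℝ) + 1) ^ (1 - α) ≤ (R : ℝ) ^ (2 - α) := by
      rw [mul_sum]
      calc ∑ r ∈ range R, (2 - α) * ((r : ℝ) + 1) ^ (1 - α)
          ≤ ∑ r ∈ range R, ((((r + 1 : ℕ) : ℝ)) ^ (2 - α) - (r : ℝ) ^ (2 - α)) :=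
            sum_le_sum fun r _ => by push_cast; exact htel r
        _ = ((R : ℕ) : ℝ) ^ (2 - α) - ((0 : ℕ) : ℝ) ^ (2 - α) :=
            sum_range_sub (fun i : ℕ => (i : ℝ) ^ (2 - α)) R
        _ = (R : ℝ) ^ (2 - α) := by rw [Nat.cast_zero, Real.zero_rpow hs.ne', sub_zero]
    have hdiv : ∑ r ∈ range R, ((r : ℝ) + 1) ^ (1 - α) ≤ (R : ℝ) ^ (2 - α) / (2 - α) := by
      rw [le_div_iff₀ hs, mul_comm]; exact hsum
    calc ∑ r ∈ range R, ((r : ℝ) + 1) ^ (1 - α) ≤ (R : ℝ) ^ (2 - α) / (2 - α) := hdiv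
      _ = (1 / (2 - α)) * (R : ℝ) ^ (2 - α) := by ring
      _ ≤ (1 + 1 / (2 - α)) * (R : ℝ) ^ (2 - α) :=
          mul_le_mul_of_nonneg_right (by linarith) hRs

/-! ### The window sum on the torus -/

/-- **Window sum bound, `0 ≤ α < 2`.** For every `η > 0` and every side `L ≥ 1`,
`Σ_{m ≠ 0, |q_m|² < η²} (|q_m|²)^{-α/2} ≤ 8 (1 + 1/(2-α)) η^{2-α} L²`. [folklore] -/
theorem wls_window_sum_le {α : ℝ} (hα0 : 0 ≤ α) (hα : α < 2) {η : ℝ} (hη : 0 < η)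
    (L : ℕ) [NeZero L] :
    (∑ m ∈ (Finset.univ.filter fun m : TorusSite 2 L => m ≠ 0 ∧ momentumNormSq L m < η ^ 2),
        (momentumNormSq L m ^ (α / 2))⁻¹) ≤
      8 * (1 + 1 / (2 - α)) * η ^ (2 - α) * (L : ℝ) ^ 2 := by
  set W := Finset.univ.filter fun m : TorusSite 2 L => m ≠ 0 ∧ momentumNormSq L m < η ^ 2
    with hW
  have hs : 0 < 2 - α := sub_pos.2 hα
  have hC : 0 ≤ 1 + 1 / (2 - α) := by have := one_div_pos.2 hs; linarith
  have hL : (0 : ℝ) < L := Nat.cast_pos.2 (Nat.pos_of_ne_zero (NeZero.ne L))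
  set D : ℝ := (L : ℝ) / (2 * Real.pi) with hD
  have hD0 : 0 < D := by positivity
  have hc : 2 * Real.pi / (L : ℝ) = D⁻¹ := by rw [hD, inv_div]
  have hDL : D ≤ L := div_le_self hL.le (by linarith [Real.pi_gt_three])
  -- the summand in the integer coordinates `v(m) = (valMinAbs mᵢ)ᵢ`
  have hDα : ∀ N : ℝ, 0 ≤ N → ((D⁻¹ ^ 2 * N) ^ (α / 2))⁻¹ = D ^ α * N ^ (-(α / 2)) := by
    intro N hN
    rw [Real.mul_rpow (sq_nonneg _) hN, mul_inv, ← Real.rpow_neg hN, ← Real.rpow_two D⁻¹,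
      ← Real.rpow_mul (inv_nonneg.2 hD0.le), Real.inv_rpow hD0.le, inv_inv,
      show (2 : ℝ) * (α / 2) = α by ring]
  have hterm : ∀ m : TorusSite 2 L, (momentumNormSq L m ^ (α / 2))⁻¹ =
      D ^ α * (∑ i, (((m i).valMinAbs : ℤ) : ℝ) ^ 2) ^ (-(α / 2)) := by
    intro m
    rw [momentumNormSq_apply, hc]
    exact hDα _ (sum_nonneg fun _ _ => sq_nonneg _)
  -- injectivity of the integer coordinates
  have hinj : Set.InjOn (fun m : TorusSite 2 L => fun i => (m i).valMinAbs) W := by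
    intro m _ m' _ h
    funext i
    have hi : (m i).valMinAbs = (m' i).valMinAbs := congr_fun h i
    exact ZMod.valMinAbs_inj.1 hi
  -- the window lands in the punctured box `[-R,R]² ∖ 0`, `R = ⌊ηL/2π⌋`
  set R : ℕ := ⌊η * D⌋₊ with hR
  have hRle : (R : ℝ) ≤ η * D := Nat.floor_le (by positivity)
  have himage : W.image (fun m : TorusSite 2 L => fun i => (m i).valMinAbs) ⊆
      (piFinset fun _ : Fin 2 => Icc (-(R : ℤ)) R).filter (· ≠ 0) := by
    intro v hv
    rw [mem_image] at hv
    obtain ⟨m, hm, rfl⟩ := hv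
    rw [hW, mem_filter] at hm
    obtain ⟨-, hm0, hmη⟩ := hm
    rw [mem_filter, mem_piFinset]
    refine ⟨fun i => ?_, fun h0 => hm0 (funext fun i => ?_)⟩
    · -- `|valMinAbs mᵢ| ≤ R`
      show (m i).valMinAbs ∈ Icc (-(R : ℤ)) R
      have hN : ∑ j, (((m j).valMinAbs : ℤ) : ℝ) ^ 2 < (η * D) ^ 2 := by
        rw [momentumNormSq_apply, hc, inv_pow] at hmη
        calc ∑ j, (((m j).valMinAbs : ℤ) : ℝ) ^ 2 < D ^ 2 * η ^ 2 :=
              (inv_mul_lt_iff₀ (pow_pos hD0 2)).1 hmη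
          _ = (η * D) ^ 2 := by ring
      have hi : (((m i).valMinAbs : ℤ) : ℝ) ^ 2 < (η * D) ^ 2 :=
        lt_of_le_of_lt (single_le_sum (f := fun j => (((m j).valMinAbs : ℤ) : ℝ) ^ 2)
          (fun j _ => sq_nonneg _) (mem_univ i)) hN
      have habs : |(((m i).valMinAbs : ℤ) : ℝ)| < η * D := abs_lt_of_sq_lt_sq hi (by positivity)
      have hnat : (((m i).valMinAbs.natAbs : ℕ) : ℝ) ≤ η * D := by
        rw [Nat.cast_natAbs, Int.cast_abs]; exact habs.le
      have hle : (m i).valMinAbs.natAbs ≤ R := Nat.le_floor hnat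
      have hle' : |(m i).valMinAbs| ≤ (R : ℤ) := by
        rw [← Int.natCast_natAbs]; exact_mod_cast hle
      exact mem_Icc.2 (abs_le.1 hle')
    · have hi : (m i).valMinAbs = 0 := congr_fun h0 i
      exact (ZMod.valMinAbs_eq_zero (m i)).1 hi
  -- assemble
  calc ∑ m ∈ W, (momentumNormSq L m ^ (α / 2))⁻¹
      = ∑ m ∈ W, D ^ α * (∑ i, (((m i).valMinAbs : ℤ) : ℝ) ^ 2) ^ (-(α / 2)) :=
        sum_congr rfl fun m _ => hterm m
    _ = D ^ α * ∑ m ∈ W, (∑ i, (((m i).valMinAbs : ℤ) : ℝ) ^ 2) ^ (-(α / 2)) := by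
        rw [mul_sum]
    _ = D ^ α * ∑ v ∈ W.image (fun m : TorusSite 2 L => fun i => (m i).valMinAbs),
          (∑ i, ((v i : ℤ) : ℝ) ^ 2) ^ (-(α / 2)) := by rw [sum_image hinj]
    _ ≤ D ^ α * ∑ v ∈ (piFinset fun _ : Fin 2 => Icc (-(R : ℤ)) R).filter (· ≠ 0),
          (∑ i, ((v i : ℤ) : ℝ) ^ 2) ^ (-(α / 2)) :=
        mul_le_mul_of_nonneg_left
          (sum_le_sum_of_subset_of_nonneg himage fun v _ _ => by positivity) (by positivity)
    _ ≤ D ^ α * (8 * ∑ r ∈ range R, ((r : ℝ) + 1) ^ (1 - α)) :=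
        mul_le_mul_of_nonneg_left (wls_shell_sum_le hα0 R) (by positivity)
    _ ≤ D ^ α * (8 * ((1 + 1 / (2 - α)) * (R : ℝ) ^ (2 - α))) := by
        gcongr; exact wls_sum_rpow_le hα R
    _ ≤ D ^ α * (8 * ((1 + 1 / (2 - α)) * (η * D) ^ (2 - α))) :=
        mul_le_mul_of_nonneg_left (mul_le_mul_of_nonneg_left (mul_le_mul_of_nonneg_left
          (Real.rpow_le_rpow (Nat.cast_nonneg R) hRle hs.le) hC) (by norm_num)) (by positivity)
    _ = 8 * (1 + 1 / (2 - α)) * η ^ (2 - α) * D ^ 2 := by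
        have hDD : D ^ α * D ^ (2 - α) = D ^ 2 := by
          rw [← Real.rpow_add hD0, show α + (2 - α) = 2 by ring, Real.rpow_two]
        rw [Real.mul_rpow hη.le hD0.le, ← hDD]
        ring
    _ ≤ 8 * (1 + 1 / (2 - α)) * η ^ (2 - α) * (L : ℝ) ^ 2 :=
        mul_le_mul_of_nonneg_left (pow_le_pow_left₀ hD0.le hDL 2)
          (mul_nonneg (mul_nonneg (by norm_num) hC) (Real.rpow_nonneg hη.le _))

/-- **Window sum bound with a prescribed `ε`, `0 ≤ α < 2`.** There is `η₁ ∈ (0, 1]` such that for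
all `0 < η ≤ η₁` and all sides `L ≥ 1` the window sum is `≤ ε L²`. [folklore] -/
theorem wls_exists {α : ℝ} (hα0 : 0 ≤ α) (hα : α < 2) {ε : ℝ} (hε : 0 < ε) :
    ∃ η₁ : ℝ, 0 < η₁ ∧ η₁ ≤ 1 ∧ ∀ η : ℝ, 0 < η → η ≤ η₁ → ∀ (L : ℕ) [NeZero L],
      (∑ m ∈ (Finset.univ.filter fun m : TorusSite 2 L => m ≠ 0 ∧ momentumNormSq L m < η ^ 2),
        (momentumNormSq L m ^ (α / 2))⁻¹) ≤ ε * (L : ℝ) ^ 2 := by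
  have hs : 0 < 2 - α := sub_pos.2 hα
  obtain ⟨C, hC, hbound⟩ : ∃ C : ℝ, 0 < C ∧ ∀ η : ℝ, 0 < η → ∀ (L : ℕ) [NeZero L],
      (∑ m ∈ (Finset.univ.filter fun m : TorusSite 2 L => m ≠ 0 ∧ momentumNormSq L m < η ^ 2),
        (momentumNormSq L m ^ (α / 2))⁻¹) ≤ C * η ^ (2 - α) * (L : ℝ) ^ 2 :=
    ⟨8 * (1 + 1 / (2 - α)), by have := one_div_pos.2 hs; linarith,
      fun η hη L _ => wls_window_sum_le hα0 hα hη L⟩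
  refine ⟨min 1 ((ε / C) ^ (2 - α)⁻¹), lt_min one_pos (Real.rpow_pos_of_pos (div_pos hε hC) _),
    min_le_left _ _, fun η hη hη₁ L _ => ?_⟩
  have hη' : η ^ (2 - α) ≤ ε / C :=
    calc η ^ (2 - α) ≤ ((ε / C) ^ (2 - α)⁻¹) ^ (2 - α) :=
          Real.rpow_le_rpow hη.le (hη₁.trans (min_le_right _ _)) hs.le
      _ = ε / C := Real.rpow_inv_rpow (div_pos hε hC).le hs.ne'
  calc _ ≤ C * η ^ (2 - α) * (L : ℝ) ^ 2 := hbound η hη L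
    _ ≤ C * (ε / C) * (L : ℝ) ^ 2 := by gcongr
    _ = ε * (L : ℝ) ^ 2 := by rw [mul_div_cancel₀ ε hC.ne']

/-- **Stub `stub_windowLatticeSum`** of the line `pair-yrast-landau-floor` (crux `SsbToEvenTorusLro`):
the two-dimensional punctured-window lattice sum. For `α < 2` and `ε > 0` there is `η₁ > 0` such
that for all windows `0 < η ≤ η₁` and all large sides `L`,
`Σ_{m ≠ 0, |q_m|² < η²} (|q_m|²)^{-α/2} ≤ ε L²` (`|q_m|² = momentumNormSq L m`,
`q_m = 2π·valMinAbs(m)/L`): sup-norm shells in `ℤ²` give the Riemann-sum count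
`≤ 8(1 + 1/(2-α)) η^{2-α} L²` for `0 ≤ α < 2`, and for `α < 0` each summand is `≤ 1` on the
window `|q_m|² < η² ≤ 1`, reducing to `α = 0`. [folklore] -/
theorem stub_windowLatticeSum :
    ∀ α : ℝ, α < 2 → ∀ ε : ℝ, 0 < ε → ∃ η₁ : ℝ, 0 < η₁ ∧ ∀ η : ℝ, 0 < η → η ≤ η₁ → ∃ L₀ : ℕ, ∀ (L : ℕ) [NeZero L], L₀ ≤ L → (∑ m ∈ (Finset.univ.filter fun m : TorusSite 2 L => m ≠ 0 ∧ momentumNormSq L m < η ^ 2), (momentumNormSq L m ^ (α / 2))⁻¹) ≤ ε * (L : ℝ) ^ 2 := by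
  intro α hα ε hε
  rcases le_or_gt 0 α with hα0 | hα0
  · obtain ⟨η₁, hη₁, -, h⟩ := wls_exists hα0 hα hε
    exact ⟨η₁, hη₁, fun η hη hηη₁ => ⟨0, fun L _ _ => h η hη hηη₁ L⟩⟩
  · obtain ⟨η₁, hη₁, hη₁1, h⟩ := wls_exists le_rfl two_pos hε
    refine ⟨η₁, hη₁, fun η hη hηη₁ => ⟨0, fun L _ _ => le_trans ?_ (h η hη hηη₁ L)⟩⟩
    refine sum_le_sum fun m hm => ?_
    rw [mem_filter] at hm
    obtain ⟨-, hm0, hmη⟩ := hm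
    have hpos : 0 < momentumNormSq L m :=
      (momentumNormSq_nonneg m).lt_of_ne' (fun h0 => hm0 ((momentumNormSq_eq_zero_iff m).1 h0))
    have hη1 : η ^ 2 ≤ 1 := pow_le_one₀ hη.le (hηη₁.trans hη₁1)
    have hle1 : momentumNormSq L m ≤ 1 := by linarith
    rw [zero_div, Real.rpow_zero, inv_one]
    exact inv_le_one_of_one_le₀
      (Real.one_le_rpow_of_pos_of_le_one_of_nonpos hpos hle1 (by linarith))

end Summit.HubbardSuperconductivity.HubbardSuperconductivity.Theorems
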